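import Summits.AtomisticToContinuum.BoseEinsteinCondensation.Theorems.BECHeatBathGapSquareSummableInfluenceLeastSquares
import Summits.AtomisticToContinuum.BoseEinsteinCondensation.Theorems.BECHeatBathGapSquareSummableInfluenceUniformWindow
import Literature.MathematicalPhysics.QuantumManyBody.GroundState
import HarnessLib

/-!
# Route `BECHeatBathGap`, crux `SquareSummableInfluence` (stmt-AtomisticToContinuum-14368), line `registered`:
# the PREDICTOR-FREE (least-squares / conditional-variance) form of the physics leaf

Supports (does not close) stmt-AtomisticToContinuum-14368 (lead c5); sequel of
`BECHeatBathGapSquareSummableInfluenceLeastSquares.lean` (the optimal blind predictor `g⋆_i` = fibrewise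
conditional least squares: it beats every blind predictor, and a bounded truncation of it comes within any
`η > 0`).

* `allGroundStatesInfluence_iff_leastSquares` — the registered leaf `stub_allGroundStatesInfluence` (the
  all-ground-states pair form of card A2: for every `N`-body ground state `Θ₀` some `(N+1)`-body ground state
  `Ψ₀` and SOME bounded measurable blind predictors with total influence `≤ ε`) is EQUIVALENT to its
  predictor-free form `∑_i ∫_{Λ^{N+1}} |Ψ₀ − g⋆_i Θ₀(tail)|² ≤ ε`,
  `g⋆_i(Z) = ∫ conj Θ₀(tail Z^{i→x}) Ψ₀(Z^{i→x}) dx / ∫ |Θ₀(tail Z^{i→x})|² dx` — for `Θ₀ > 0` the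
  conditional-variance form `∑_i ∫dy E_{Θ₀²}[Var_i(Ψ₀(y,·)/Θ₀)] ≤ ε`, i.e. `Tr(Γ_X G_{Θ₀}) ≤ ε` with
  `G_{Θ₀} = ∑_i (1 − P_i)` the heat-bath Dirichlet form of `|Θ₀|²` over particle labels and `Γ_X` the `N`-body
  reduced state of `Ψ₀` (lead c4's operator form, until now prose);
* `squareSummableInfluence_of_leastSquaresForm` — that form implies the crux `SquareSummableInfluence` BY NAME
  (through the landed reduction `squareSummableInfluence_of_allGroundStatesForm`): the quantifier-minimal
  re-typing of the leaf (`∀Θ₀ ∃Ψ₀`, one closed-form inequality, no `∃ g ∃ M`).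

No new definitions (the predictor is written out); `[folklore]`.
-/

noncomputable section

open MeasureTheory Filter Function
open scoped ENNReal NNReal Topology ComplexConjugate

namespace Summit.AtomisticToContinuum.BoseEinsteinCondensation.Theorems.SquareSummableInfluence

open Literature.MathematicalPhysics.QuantumManyBody.BoseGas

/-! ### The predictor-free form of the leaf `stub_allGroundStatesInfluence` -/

/-- **The physics leaf of the crux `SquareSummableInfluence` (registered stub
`stub_allGroundStatesInfluence`, the all-ground-states pair form of card A2) is EQUIVALENT to its
predictor-free least-squares form.** Left: the registered stub verbatim (for every `N`-body ground state
`Θ₀` some `(N+1)`-body ground state `Ψ₀` and SOME bounded measurable blind predictors `g_i` with total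
influence `≤ ε`). Right: the same with the quantifier over predictors removed — the total LEAST-SQUARES
influence `∑_i ∫_{Λ^{N+1}} |Ψ₀ − g⋆_i Θ₀(tail)|² ≤ ε`, `g⋆_i(Z) = ∫conj Θ₀(tail Z^{i→x})Ψ₀(Z^{i→x})dx / ∫|Θ₀(tail Z^{i→x})|²dx`
the fibrewise conditional-mean amplitude (for `Θ₀ > 0`: `∑_i ∫dy E_{Θ₀²}[Var_i(Ψ₀(y,·)/Θ₀)] ≤ ε`, i.e.
`Tr(Γ_X G_{Θ₀}) ≤ ε` with `G_{Θ₀} = ∑_i (1 − P_i)` the heat-bath Dirichlet form of `|Θ₀|²` over particle labels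
and `Γ_X` the `N`-body reduced state of `Ψ₀`). `→`: least squares beats the stub's predictors
(`lintegral_sub_leastSquares_mul_tail_sq_le`); `←`: at tolerance `ε/2`, truncate each `g⋆_i` at cost
`ε/(2(N+1))` (`exists_bounded_blind_lintegral_le_leastSquares_add`) and take the largest of the `N` bounds.
[folklore] -/
theorem allGroundStatesInfluence_iff_leastSquares :
    (∀ v : ℝ → ℝ≥0∞, IsRepulsiveFiniteRange v → ∀ ε : ℝ, 0 < ε →
      ∃ ρ₀ : ℝ, 0 < ρ₀ ∧ ∀ ρ : ℝ, 0 < ρ → ρ < ρ₀ → ∀ᶠ N : ℕ in atTop,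
        ∀ Θ₀ : Config N → ℂ, IsGroundState v (sideLength ρ (N + 1)) Θ₀ →
          ∃ Ψ₀ : Config (N + 1) → ℂ, IsGroundState v (sideLength ρ (N + 1)) Ψ₀ ∧
          ∃ g : Fin N → Config (N + 1) → ℂ,
            (∀ i, Measurable (g i)) ∧ (∃ M : ℝ, ∀ i Z, ‖g i Z‖ ≤ M) ∧
            (∀ i Z x, g i (Function.update Z (Fin.succ i) x) = g i Z) ∧
            (∑ i : Fin N, ∫⁻ Z in boxN (N + 1) (sideLength ρ (N + 1)),
                (‖Ψ₀ Z - g i Z * Θ₀ (Matrix.vecTail Z)‖₊ : ℝ≥0∞) ^ 2) ≤ ENNReal.ofReal ε) ↔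
    (∀ v : ℝ → ℝ≥0∞, IsRepulsiveFiniteRange v → ∀ ε : ℝ, 0 < ε →
      ∃ ρ₀ : ℝ, 0 < ρ₀ ∧ ∀ ρ : ℝ, 0 < ρ → ρ < ρ₀ → ∀ᶠ N : ℕ in atTop,
        ∀ Θ₀ : Config N → ℂ, IsGroundState v (sideLength ρ (N + 1)) Θ₀ →
          ∃ Ψ₀ : Config (N + 1) → ℂ, IsGroundState v (sideLength ρ (N + 1)) Ψ₀ ∧
            (∑ i : Fin N, ∫⁻ Z in boxN (N + 1) (sideLength ρ (N + 1)),
              (‖Ψ₀ Z -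
                ((∫ x in box (sideLength ρ (N + 1)), conj (Θ₀ (Matrix.vecTail (Function.update Z (Fin.succ i) x))) *
                  Ψ₀ (Function.update Z (Fin.succ i) x)) /
                (((∫⁻ x in box (sideLength ρ (N + 1)),
                    (‖Θ₀ (Matrix.vecTail (Function.update Z (Fin.succ i) x))‖₊ : ℝ≥0∞) ^ 2).toReal : ℝ) : ℂ)) *
                  Θ₀ (Matrix.vecTail Z)‖₊ : ℝ≥0∞) ^ 2) ≤ ENNReal.ofReal ε) := by
  -- square integrability on the boxes of ground states (they are normalised on the whole space)
  have hsq : ∀ {n : ℕ} {v : ℝ → ℝ≥0∞} {L : ℝ} {Φ : Config n → ℂ}, IsGroundState v L Φ →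
      ∫⁻ X in boxN n L, (‖Φ X‖₊ : ℝ≥0∞) ^ 2 ≠ ⊤ := fun hΦ =>
    ne_top_of_le_ne_top (by rw [hΦ.norm_eq]; exact ENNReal.one_ne_top) (setLIntegral_le_lintegral _ _)
  constructor
  · intro h v hv ε hε
    obtain ⟨ρ₀, hρ₀, H⟩ := h v hv ε hε
    refine ⟨ρ₀, hρ₀, fun ρ hρ hρlt => ?_⟩
    filter_upwards [H ρ hρ hρlt] with N hN Θ₀ hΘ₀
    obtain ⟨Ψ₀, hΨ₀, g, hgm, _, hgi, hsum⟩ := hN Θ₀ hΘ₀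
    refine ⟨Ψ₀, hΨ₀, le_trans (Finset.sum_le_sum fun i _ => ?_) hsum⟩
    exact lintegral_sub_leastSquares_mul_tail_sq_le N (sideLength ρ (N + 1)) Θ₀ Ψ₀ hΘ₀.measurable
      hΨ₀.measurable (hsq hΘ₀) (hsq hΨ₀) i (g i) (hgm i) (hgi i)
  · intro h v hv ε hε
    obtain ⟨ρ₀, hρ₀, H⟩ := h v hv (ε / 2) (half_pos hε)
    refine ⟨ρ₀, hρ₀, fun ρ hρ hρlt => ?_⟩
    filter_upwards [H ρ hρ hρlt] with N hN Θ₀ hΘ₀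
    obtain ⟨Ψ₀, hΨ₀, hsum⟩ := hN Θ₀ hΘ₀
    -- truncate each least-squares predictor at cost `η = ε / (2 (N + 1))`
    have hη : (0 : ℝ≥0∞) < ENNReal.ofReal (ε / (2 * (N + 1))) := ENNReal.ofReal_pos.2 (by positivity)
    choose g hgm hgM hgi hgle using fun i : Fin N =>
      exists_bounded_blind_lintegral_le_leastSquares_add N (sideLength ρ (N + 1)) Θ₀ Ψ₀ hΘ₀.measurable
        hΨ₀.measurable (hsq hΨ₀) i _ hη
    choose M hM using hgM
    refine ⟨Ψ₀, hΨ₀, g, hgm, ⟨∑ j, max (M j) 0, fun i Z => ?_⟩, hgi, ?_⟩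
    · exact ((hM i Z).trans (le_max_left _ _)).trans
        (Finset.single_le_sum (f := fun j => max (M j) 0) (fun j _ => le_max_right _ _)
          (Finset.mem_univ i))
    · calc (∑ i : Fin N, ∫⁻ Z in boxN (N + 1) (sideLength ρ (N + 1)),
              (‖Ψ₀ Z - g i Z * Θ₀ (Matrix.vecTail Z)‖₊ : ℝ≥0∞) ^ 2)
          ≤ ∑ i : Fin N, ((∫⁻ Z in boxN (N + 1) (sideLength ρ (N + 1)),
              (‖Ψ₀ Z -
                ((∫ x in box (sideLength ρ (N + 1)), conj (Θ₀ (Matrix.vecTail (Function.update Z (Fin.succ i) x))) *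
                  Ψ₀ (Function.update Z (Fin.succ i) x)) /
                (((∫⁻ x in box (sideLength ρ (N + 1)),
                    (‖Θ₀ (Matrix.vecTail (Function.update Z (Fin.succ i) x))‖₊ : ℝ≥0∞) ^ 2).toReal : ℝ) : ℂ)) *
                  Θ₀ (Matrix.vecTail Z)‖₊ : ℝ≥0∞) ^ 2) + ENNReal.ofReal (ε / (2 * (N + 1)))) :=
            Finset.sum_le_sum fun i _ => hgle i
        _ ≤ ENNReal.ofReal (ε / 2) + (N : ℝ≥0∞) * ENNReal.ofReal (ε / (2 * (N + 1))) := by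
            rw [Finset.sum_add_distrib, Finset.sum_const, Finset.card_univ, Fintype.card_fin, nsmul_eq_mul]
            gcongr
        _ ≤ ENNReal.ofReal (ε / 2) + ENNReal.ofReal (ε / 2) := by
            gcongr
            rw [← ENNReal.ofReal_natCast, ← ENNReal.ofReal_mul (Nat.cast_nonneg N)]
            refine ENNReal.ofReal_le_ofReal ?_
            rw [mul_div_assoc']
            rw [div_le_div_iff₀ (by positivity) (by positivity)]
            nlinarith [hε.le, (Nat.cast_nonneg N : (0 : ℝ) ≤ N)]
        _ = ENNReal.ofReal ε := by
            rw [← ENNReal.ofReal_add (by positivity) (by positivity), add_halves]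

/-- **The crux `SquareSummableInfluence` from the predictor-free least-squares leaf** (BY NAME): if at low
density and eventually in `N` every `N`-body Dirichlet ground state `Θ₀` in the box of side `((N+1)/ρ)^{1/3}`
admits an `(N+1)`-body ground state `Ψ₀` whose total least-squares single-bath-particle influence
`∑_i ∫ |Ψ₀ − g⋆_i Θ₀(tail)|²` is `≤ ε`, then `SquareSummableInfluence` holds —
`allGroundStatesInfluence_iff_leastSquares` followed by the landed reduction
`squareSummableInfluence_of_allGroundStatesForm` (uniform slack window by compactness, then the ground-state
form of the crux). This is the re-typed, quantifier-minimal leaf of card A2. [folklore] -/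
theorem squareSummableInfluence_of_leastSquaresForm :
    (∀ v : ℝ → ℝ≥0∞, IsRepulsiveFiniteRange v → ∀ ε : ℝ, 0 < ε →
      ∃ ρ₀ : ℝ, 0 < ρ₀ ∧ ∀ ρ : ℝ, 0 < ρ → ρ < ρ₀ → ∀ᶠ N : ℕ in atTop,
        ∀ Θ₀ : Config N → ℂ, IsGroundState v (sideLength ρ (N + 1)) Θ₀ →
          ∃ Ψ₀ : Config (N + 1) → ℂ, IsGroundState v (sideLength ρ (N + 1)) Ψ₀ ∧
            (∑ i : Fin N, ∫⁻ Z in boxN (N + 1) (sideLength ρ (N + 1)),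
              (‖Ψ₀ Z -
                ((∫ x in box (sideLength ρ (N + 1)), conj (Θ₀ (Matrix.vecTail (Function.update Z (Fin.succ i) x))) *
                  Ψ₀ (Function.update Z (Fin.succ i) x)) /
                (((∫⁻ x in box (sideLength ρ (N + 1)),
                    (‖Θ₀ (Matrix.vecTail (Function.update Z (Fin.succ i) x))‖₊ : ℝ≥0∞) ^ 2).toReal : ℝ) : ℂ)) *
                  Θ₀ (Matrix.vecTail Z)‖₊ : ℝ≥0∞) ^ 2) ≤ ENNReal.ofReal ε) →
    Summit.AtomisticToContinuum.BoseEinsteinCondensation.Theses.BECHeatBathGap.SquareSummableInfluence :=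
  fun h => squareSummableInfluence_of_allGroundStatesForm (allGroundStatesInfluence_iff_leastSquares.2 h)

end Summit.AtomisticToContinuum.BoseEinsteinCondensation.Theorems.SquareSummableInfluence

end
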